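import Literature.NumberTheory.GelbartRogawski1991.PiSCompletionIsThetaTypeTestSignedW1 -- ★ p848883 (D-b)ᵀˢ-W1 DEF `piSCompletion_isThetaTypeAtCMTestSignedW1` (head token BY NAME)
import Literature.NumberTheory.Rogawski1990.LocalTransferExistence                 -- ★ (H₇) `IsLocalDeltaTransferExists`
import Literature.NumberTheory.Rogawski1990.FinExplicitTransferFactorConjLeft      -- ★ print's `Δ‴` = `finExplicitCollection` + `finExplicitDelta_conj_left_all` (r359 ⑨ pin)
import Literature.NumberTheory.Rogawski1990.FinExplicitTransferFactorConjRight     -- ★ `finExplicitDelta_conj_right_all`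
import Literature.NumberTheory.Automorphic.OrbitalMeasureCanonical                 -- ★ `OrbitalMeasureFamily.IsCanonical` (canonical orbital measures, r359 ⑨ pin)
import Summits.HodgeConjecture.HodgeConjecture.Theorems.F0P3cDbTThetaOccurrenceLiuLocus -- ★ (O1-W1) closer `stubThetaLiftMember_liuLocus` (LH10-p02 p848642, commit da5c4edfd102)
import HarnessLib

/-!
# LH10 «Θ-ROAD» for (D-b)ᵀˢ-W1 — the LOCAL residual organ (O2θ-W1) and the sorry-free head `dbTSAtRecordW1_of_thetaRoad`

Books row #76 «(D-b)ᵀ» [GelbartRogawski1991 §5.1 Lem. 5.1.2, non-split case] (crux H413 = stmt-HodgeConjecture-24833), half-A line LH10 (leaf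
`Cruxes/H413/Lines/F0_P3c_DbTPaydown.lean` ED. 6 «β»).  The leaf pays the W1 head `DbTSAtRecordW1` (= ★∕⊢ `piSCompletion_isThetaTypeAtCMTestSignedW1` at print's pinned
data) from ★ (O1-W1) `F0P3cDbTThetaOccurrenceLiuLocus.stubThetaLiftMember_liuLocus` and ONE print organ (O2♮) `StubXiPacketRigidCoreSc` — a GLOBAL rigidity statement for the
inner form `U(H)` («every supercuspidal `v`-constituent of a discrete `Π(ξ)`-family member `P` completes `πⁿ(ξ_v) ∘ e` in the signed (13.1.4)», print
[Rogawski1990 Thm. 13.3.6 (c) + §14.6 Thm. 14.6.1 ∕ 14.6.4; Prop. 13.1.3 (d), 13.1.4]).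

THIS FILE records the ONE alternative typing of the residual — the «Θ-ROAD» — which is LOCAL and cites the row's OWN source:

* `StubThetaTypeScCompletesW1` **(O2θ-W1) «A SUPERCUSPIDAL CM-THETA TYPE COMPLETES πⁿ(ξ_v)»**: at print's pinned data (`Δ = Δ‴`, canonical orbital measures, Haar, the
  SIGNED package, (H₇)), for every DICT-tied pair `(μ, χ_f)` on the weight-one ∕ automorphic locus, every non-split finite `v`, every form congruence `ᵗT̄·H_v·T = a·Φ₃`,
  every Keys-labelled `(π², πⁿ)` with `πⁿ` not square-integrable, EVERY line class `ε` and EVERY class `c` of `U(H)(L⁺_v)`: if `c` IS the theta type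
  `X_v(μ, ε, χ_f) ∘ κ_v⁻¹` (★ `ThetaTypeAtCM`) and `c` is supercuspidal, then `⟨πⁿ ∘ e, some c⟩` satisfies the SIGNED (13.1.4) on test functions at `ξ.xiLocalChar v`.
  In print: `X_v(μ,ε,χ_f) = ω(γ_v, ψ_v^ε, χ_v)|_{U(3)}` is irreducible and equals `πⁿ(ξ_v)` or `πˢ(ξ_v)` [GelbartRogawski1991 (5.1.1), Lem. 5.1.2 p. 466, with the §1.4 ∕ Thm. 3.4
  dictionary `ξ ↔ (γ, χ)`]; supercuspidal ⇒ `= πˢ(ξ_v)`; and `ρ(ξ_v) = {πⁿ(ξ_v), πˢ(ξ_v)}` satisfies (13.1.4) [Rogawski1990 Prop. 13.1.3 (d), Prop. 13.1.4 p. 199; signs §4.9].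
  NO automorphic representation `P`, NO automorphic measure `μA`, NO §13.3 ∕ §14.6 global rigidity enters the statement.  PRINT organ (count-neutral): GR91's own proof of
  Lem. 5.1.2 is global ([R₂] multiplicity formula + Thm. 5.1.1; Remark p. 466: a local proof would reduce to the (U(1),U(1)) Howe statement Cor. 5.2.2), and the tree has no
  local character computation of the Weil piece — the in-house road is the banked programme P7 (local theta U(1)×U(3) non-split; A-p17 (g15) census).
* `dbTSAtRecordW1_of_thetaRoad` **HEAD-Θ**: `StubThetaTypeScCompletesW1 → ‹the body of the leaf's DbTSAtRecordW1, verbatim›`, PROVED (no `sorry`) from ★ (O1-W1) in three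
  lines: (O1-W1) supplies `ε` and a SUPERCUSPIDAL `v`-constituent `c₀` of its theta member with `ThetaTypeAtCM … ε v c₀`; (O2θ-W1) completes `πⁿ ∘ e` by `c₀`.  So a leaf
  edition importing this file gets `theorem Db_T_of_thetaRoadW1 (O2θ : StubThetaTypeScCompletesW1) : DbTSAtRecordW1 := dbTSAtRecordW1_of_thetaRoad O2θ` (δ-unfolding), and
  (O2θ-W1)'s hypotheses are kernel-certified NON-VACUOUS on the W1 locus (they are met at (O1-W1)'s witness — exactly where the head applies them).

RELATION TO (O2♮): neither implies the other by logic — (O2♮) quantifies over all discrete `Π(ξ)`-family members `P` of `U(H)` (global, inner form, envelope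
`MemXiFamily`), (O2θ-W1) over all supercuspidal theta types of DICT-tied CM data (local, no `P`).  Both are print-true; (O2θ-W1) is the statement whose cite IS books row #76's
([GelbartRogawski1991 Lem. 5.1.2] πˢ-half + [Rogawski1990 13.1.3 (d)]), and it is the typed target a local in-house programme would have to hit.  This file proves NO printed
citation; it is a sorry-free implication + one `def`.  HONEST LABEL: HC_CM is proved only modulo the 7 printed citations (2 remaining named inputs: hLiu418 =
stmt-HodgeConjecture-24832, h413 = stmt-HodgeConjecture-24833) until rung 0 closes; count-neutral.

[cite: GelbartRogawski1991, §5.1 (5.1.1), Lem. 5.1.2 p. 466; Thm. 5.1.1 p. 465; §3.4 Thm. 3.4 (a) p. 461; §1.4] [cite: Rogawski1990, §13.1 Prop. 13.1.3 (d), Prop. 13.1.4 p. 199; §4.9 p. 55]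
[cite: Liu2021, Def. 4.11 (l. 2090)] [cite: LanglandsShelstad1987, §1]
-/

set_option autoImplicit false

set_option linter.dupNamespace false

noncomputable section

open NumberField IsDedekindDomain MeasureTheory
open scoped Matrix ComplexOrder

namespace Summit.HodgeConjecture.HodgeConjecture.Cruxes.H413.F0P3cDbTThetaRoadW1

open Literature.NumberTheory Literature.NumberTheory.Automorphic Literature.NumberTheory.Automorphic.UnitaryGroup
open Literature.NumberTheory.Automorphic.IdeleClassGroup
open Literature.NumberTheory.Automorphic.Liu2021 Literature.NumberTheory.Automorphic.Liu2021.Def411WeilCarriers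
open Literature.NumberTheory.GaloisRepresentations
open Literature.NumberTheory.Rogawski1990 Literature.NumberTheory.GelbartRogawski1991

open scoped Classical in
/-- **(O2θ-W1) «A SUPERCUSPIDAL CM-THETA TYPE COMPLETES πⁿ(ξ_v) ∘ e IN THE SIGNED (13.1.4) ON TEST FUNCTIONS»** — the LOCAL residual organ of the Θ-road.
Binders = (O2♮) `F0P3cDbTPaydown.StubXiPacketRigidCoreSc`'s pinned-data block VERBATIM (through (H₇)), then — in place of `(ξ μA P, MemXiFamily P …)` — the W1 head's own
local block: `e₁ dV hdV hdV0 g hg ξ μ hμ χf`, continuity, unit norm, `HasWeight L μ 1`, `IsAutomorphicOneChar … χf`, the two DICT ties, the non-split `v`, the form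
congruence, `μZ`, the Keys labels, `¬ πⁿ` square-integrable; conclusion: `∀ ε c, ThetaTypeAtCM … μ hμ χf ε v c → c.IsSupercuspidal → ⟨πⁿ ∘ e, some c⟩.CharIdentityAtTest …`
with member traces `× (±1)` (the sign of `a` modulo local norms) at `ξ.xiLocalChar v`.  PRINT [GelbartRogawski1991 (5.1.1), Lem. 5.1.2 (πˢ-half); Rogawski1990 Prop. 13.1.3 (d),
13.1.4]; count-neutral.  [GelbartRogawski1991, §5.1 (5.1.1), Lem. 5.1.2 p. 466; §3.4 Thm. 3.4 (a) p. 461] [Rogawski1990, §13.1 Prop. 13.1.3 (d), Prop. 13.1.4 p. 199; §4.9 p. 55] [LanglandsShelstad1987, §1] -/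
def StubThetaTypeScCompletesW1 : Prop :=
  ∀ (L : Type) [Field L] [NumberField L] [IsCMField L] (H : Matrix (Fin 3) (Fin 3) L)
    (hH : (H.map (cmConjRingHom L))ᵀ = H) (hHd : IsUnit H.det)
    [∀ v : HeightOneSpectrum (𝓞 ↥(maximalRealSubfield L)), MeasurableSpace ((cmDatum L 3 H).Local v)]
    [∀ v : HeightOneSpectrum (𝓞 ↥(maximalRealSubfield L)),
      MeasurableSpace ((cmDatum L 2 (Matrix.of fun i j : Fin 2 => if i.val + j.val + 1 = 2 then (1 : L) else 0)).Local v ×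
        (cmDatum L 1 (Matrix.of fun i j : Fin 1 => if i.val + j.val + 1 = 1 then (1 : L) else 0)).Local v)]
    [∀ (v : HeightOneSpectrum (𝓞 ↥(maximalRealSubfield L)))
        (a : ((cmDatum L 2 (Matrix.of fun i j : Fin 2 => if i.val + j.val + 1 = 2 then (1 : L) else 0)).Local v ×
          (cmDatum L 1 (Matrix.of fun i j : Fin 1 => if i.val + j.val + 1 = 1 then (1 : L) else 0)).Local v)),
      MeasurableSpace (((cmDatum L 2 (Matrix.of fun i j : Fin 2 => if i.val + j.val + 1 = 2 then (1 : L) else 0)).Local v ×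
          (cmDatum L 1 (Matrix.of fun i j : Fin 1 => if i.val + j.val + 1 = 1 then (1 : L) else 0)).Local v) ⧸
        Subgroup.centralizer ({a} : Set ((cmDatum L 2 (Matrix.of fun i j : Fin 2 => if i.val + j.val + 1 = 2 then (1 : L) else 0)).Local v ×
          (cmDatum L 1 (Matrix.of fun i j : Fin 1 => if i.val + j.val + 1 = 1 then (1 : L) else 0)).Local v)))]
    [∀ (v : HeightOneSpectrum (𝓞 ↥(maximalRealSubfield L))) (γ : (cmDatum L 3 H).Local v),
      MeasurableSpace ((cmDatum L 3 H).Local v ⧸ Subgroup.centralizer ({γ} : Set ((cmDatum L 3 H).Local v)))]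
    (Δ : ∀ v : HeightOneSpectrum (𝓞 ↥(maximalRealSubfield L)), LocalTransferFactor L H v)
    (mH : ∀ v : HeightOneSpectrum (𝓞 ↥(maximalRealSubfield L)),
      OrbitalMeasureFamily ((cmDatum L 2 (Matrix.of fun i j : Fin 2 => if i.val + j.val + 1 = 2 then (1 : L) else 0)).Local v ×
        (cmDatum L 1 (Matrix.of fun i j : Fin 1 => if i.val + j.val + 1 = 1 then (1 : L) else 0)).Local v))
    (mG : ∀ v : HeightOneSpectrum (𝓞 ↥(maximalRealSubfield L)), OrbitalMeasureFamily ((cmDatum L 3 H).Local v))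
    (νG : ∀ v : HeightOneSpectrum (𝓞 ↥(maximalRealSubfield L)), Measure ((cmDatum L 3 H).Local v))
    (νH : ∀ v : HeightOneSpectrum (𝓞 ↥(maximalRealSubfield L)),
      Measure ((cmDatum L 2 (Matrix.of fun i j : Fin 2 => if i.val + j.val + 1 = 2 then (1 : L) else 0)).Local v ×
        (cmDatum L 1 (Matrix.of fun i j : Fin 1 => if i.val + j.val + 1 = 1 then (1 : L) else 0)).Local v))
    [∀ v : HeightOneSpectrum (𝓞 ↥(maximalRealSubfield L)), BorelSpace ((cmDatum L 3 H).Local v)]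
    [∀ v : HeightOneSpectrum (𝓞 ↥(maximalRealSubfield L)),
      BorelSpace ((cmDatum L 2 (Matrix.of fun i j : Fin 2 => if i.val + j.val + 1 = 2 then (1 : L) else 0)).Local v ×
        (cmDatum L 1 (Matrix.of fun i j : Fin 1 => if i.val + j.val + 1 = 1 then (1 : L) else 0)).Local v)]
    [∀ (v : HeightOneSpectrum (𝓞 ↥(maximalRealSubfield L)))
        (a : ((cmDatum L 2 (Matrix.of fun i j : Fin 2 => if i.val + j.val + 1 = 2 then (1 : L) else 0)).Local v ×
          (cmDatum L 1 (Matrix.of fun i j : Fin 1 => if i.val + j.val + 1 = 1 then (1 : L) else 0)).Local v)),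
      BorelSpace (((cmDatum L 2 (Matrix.of fun i j : Fin 2 => if i.val + j.val + 1 = 2 then (1 : L) else 0)).Local v ×
          (cmDatum L 1 (Matrix.of fun i j : Fin 1 => if i.val + j.val + 1 = 1 then (1 : L) else 0)).Local v) ⧸
        Subgroup.centralizer ({a} : Set ((cmDatum L 2 (Matrix.of fun i j : Fin 2 => if i.val + j.val + 1 = 2 then (1 : L) else 0)).Local v ×
          (cmDatum L 1 (Matrix.of fun i j : Fin 1 => if i.val + j.val + 1 = 1 then (1 : L) else 0)).Local v)))]
    [∀ (v : HeightOneSpectrum (𝓞 ↥(maximalRealSubfield L))) (γ : (cmDatum L 3 H).Local v),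
      BorelSpace ((cmDatum L 3 H).Local v ⧸ Subgroup.centralizer ({γ} : Set ((cmDatum L 3 H).Local v)))]
    [∀ v, (νG v).IsHaarMeasure] [∀ v, (νG v).IsMulRightInvariant] [∀ v, (νH v).IsHaarMeasure] [∀ v, (νH v).IsMulRightInvariant],
    ∀ (μω : HeckeCharacter L) (hμu : μω.IsUnitary),
    (∀ x : Literature.NumberTheory.GaloisRepresentations.ideleGroup ↥(maximalRealSubfield L),
      μω (AdeleRing.ideleBaseChange (↥(maximalRealSubfield L)) L x) = quadraticHeckeCharCM L x) →
    Δ = finExplicitCollection L H μω (finExplicitDelta_conj_left_all L H μω) (finExplicitDelta_conj_right_all L H μω) →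
    (∀ v : HeightOneSpectrum (𝓞 ↥(maximalRealSubfield L)), (mH v).IsCanonical (IsLocalGRegular L v) (νH v) ∧
      (mG v).IsCanonical (fun γ => IsRegularElt (γ.val : GL (Fin 3) (UnitaryGroup.LocalRing L v))) (νG v)) →
    CMCharIdentityPackageTestSigned L H hH hHd νH νG μω hμu Δ mH mG →
    (∀ v : HeightOneSpectrum (𝓞 ↥(maximalRealSubfield L)), (∀ w : PlacesOver L v, IsCMField.complexConj L • w.1 = w.1) →
      IsLocalDeltaTransferExists L H v (Δ v) (mH v) (mG v) Literature.NumberTheory.Rogawski1990.IsLocSmooth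
        Literature.NumberTheory.Rogawski1990.IsLocSmooth) →
    ∀ {n' : ℕ} (e₁ : Fin 3 × Fin 1 ≃ Fin n') (dV : Fin 3 → L) (hdV : ∀ i, IsCMField.complexConj L (dV i) = dV i) (hdV0 : ∀ i, dV i ≠ 0)
      (g : GL (Fin 3) L) (hg : ((g : Matrix (Fin 3) (Fin 3) L).map (cmConjRingHom L))ᵀ * H * (g : Matrix (Fin 3) (Fin 3) L) = Matrix.diagonal dV)
      (ξ : OneDimAutRepH L)
      (μ : Literature.NumberTheory.Automorphic.IdeleClassGroup L →ₜ* Circle) (hμ : IsConjugateSymplectic L μ)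
      (χf : UnitaryGroup.finAdelicOne (↥(maximalRealSubfield L)) L (IsCMField.complexConj L) →* ℂˣ),
      Continuous χf → (∀ z, ‖((χf z : ℂˣ) : ℂ)‖ = 1) →
      HasWeight L μ 1 → IsAutomorphicOneChar (↥(maximalRealSubfield L)) L (IsCMField.complexConj L) χf →
      (∀ v : HeightOneSpectrum (𝓞 ↥(maximalRealSubfield L)),
          (toHeckeCharacter L μ).semilocalComponent L v = (ξ.bcη⁻¹ * ξ.bcψ⁻¹ * μω).semilocalComponent L v) →
      (∀ z : (FiniteAdeleRing (𝓞 L) L)ˣ,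
          χf (finAdelicCheck (↥(maximalRealSubfield L)) L (IsCMField.complexConj L)
              (AlgEquiv.ext fun x => by rw [AlgEquiv.mul_apply, IsCMField.complexConj_apply_apply, AlgEquiv.one_apply]) z) =
            (ξ.bcψ⁻¹ * (ξ.bcη⁻¹ * ξ.bcψ⁻¹ * μω) ^ 2)
              (Units.map (N := AdeleRing (𝓞 L) L) (MonoidHom.inr (InfiniteAdeleRing L) (FiniteAdeleRing (𝓞 L) L)) z)) →
      ∀ (v : HeightOneSpectrum (𝓞 ↥(maximalRealSubfield L))), (∀ w : PlacesOver L v, IsCMField.complexConj L • w.1 = w.1) →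
      ∀ (T : GL (Fin 3) (LocalRing L v)) (a : LocalRing L v) (ha : IsUnit a)
        (h : formCongr (conjLocal L (IsCMField.complexConj L) v) T (H.map (algebraMap L (LocalRing L v))) =
          a • (Matrix.of fun i j : Fin 3 => if i.val + j.val + 1 = 3 then (1 : L) else 0).map (algebraMap L (LocalRing L v))),
      ∀ [MeasurableSpace (Gqs L v ⧸ Subgroup.center (Gqs L v))] [BorelSpace (Gqs L v ⧸ Subgroup.center (Gqs L v))]
        (μZ : Measure (Gqs L v ⧸ Subgroup.center (Gqs L v))) [μZ.IsHaarMeasure],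
      ∀ (π2 πn : IrrClass (Gqs L v)),
        KeysCaseTwoLabels L v (μω.semilocalComponent L v) (torusLocalComponent L (IsCMField.complexConj L) v ξ.η)
          (torusLocalComponent L (IsCMField.complexConj L) v ξ.ψ) π2 πn →
        ¬ πn.IsSquareIntegrable μZ →
        -- (θ) «every SUPERCUSPIDAL theta type X_v(μ, ε, χ_f) ∘ κ_v⁻¹ completes πⁿ ∘ e in the SIGNED (13.1.4) on test functions»
        ∀ (ε : (↥(maximalRealSubfield L))ˣ) (c : IrrClass ((cmDatum L 3 H).Local v)),
          ThetaTypeAtCM L H e₁ dV hdV hdV0 g hg μ hμ χf ε v c →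
          c.IsSupercuspidal →
          (⟨IrrClass.comap (cmDatumLocalCongr L v T ha h).symm πn, some c⟩ : CMLocalAPacket L H v).CharIdentityAtTest L H v
          (fun c' f => (if ∃ z : LocalRing L v, IsUnit z ∧ a = z * conjLocal L (IsCMField.complexConj L) v z then (1 : ℂ) else -1) *
          c'.smoothTrace (νG v) f)
          (ξ.xiLocalChar v) (νH v) (Δ v) (mH v) (mG v)

set_option synthInstance.maxHeartbeats 400000 in
set_option maxHeartbeats 4000000 in
/-- **HEAD-Θ `dbTSAtRecordW1_of_thetaRoad : ‹O2θ-W1› → ‹DbTSAtRecordW1›`** — the statement is the BODY of the leaf's `F0P3cDbTPaydown.DbTSAtRecordW1` (ED. 5-W ∕ 6 «β», bytes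
:594–:649 of `Cruxes/H413/Lines/F0_P3c_DbTPaydown.lean` 832f41067d1f4a77) VERBATIM, so the leaf consumes it by δ-unfolding; the proof is the leaf's W1-β head with ★ (O1-W1)
`F0P3cDbTThetaOccurrenceLiuLocus.stubThetaLiftMember_liuLocus` inlined (at `χ := ⟨χf, haut⟩`, `hχ := rfl`) and (O2θ-W1) applied at (O1-W1)'s supercuspidal theta constituent
`c₀` — no `Exists.choose`, no completion uniqueness, no Ne-glue, no `P`-dependence left in the residual.  `--axioms` = TRIO (no `sorryAx`: the organ is a HYPOTHESIS here).
[cite: GelbartRogawski1991, Lem. 5.1.2 p. 466; Thm. 3.4 (a) p. 461] [cite: Rogawski1990, §13.1 Prop. 13.1.3 (d), 13.1.4 p. 199; §4.9 p. 55] [cite: Liu2021, Def. 4.11 (l. 2090)] -/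
theorem dbTSAtRecordW1_of_thetaRoad (O2θ : StubThetaTypeScCompletesW1) :
    ∀ (L : Type) [Field L] [NumberField L] [IsCMField L] (ι : L →+* ℂ) (H : Matrix (Fin 3) (Fin 3) L) (T : GL (Fin 3) ℂ)
    (hT : (T : Matrix (Fin 3) (Fin 3) ℂ)ᴴ * H.map ι * (T : Matrix (Fin 3) (Fin 3) ℂ) = Literature.Geometry.ComplexHyperbolic.BallModel.J)
    (hdef : ∀ τ' : L →+* ℂ, InfinitePlace.mk τ' ≠ InfinitePlace.mk ι → (H.map τ').PosDef) (h2 : 2 ≤ Module.finrank ℚ ↥(maximalRealSubfield L))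
    (hH : (H.map (cmConjRingHom L))ᵀ = H) (hHd : IsUnit H.det)
    [∀ v : HeightOneSpectrum (𝓞 ↥(maximalRealSubfield L)), MeasurableSpace ((cmDatum L 3 H).Local v)]
    [∀ v : HeightOneSpectrum (𝓞 ↥(maximalRealSubfield L)),
      MeasurableSpace ((cmDatum L 2 (Matrix.of fun i j : Fin 2 => if i.val + j.val + 1 = 2 then (1 : L) else 0)).Local v ×
        (cmDatum L 1 (Matrix.of fun i j : Fin 1 => if i.val + j.val + 1 = 1 then (1 : L) else 0)).Local v)]
    [∀ (v : HeightOneSpectrum (𝓞 ↥(maximalRealSubfield L)))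
        (a : ((cmDatum L 2 (Matrix.of fun i j : Fin 2 => if i.val + j.val + 1 = 2 then (1 : L) else 0)).Local v ×
          (cmDatum L 1 (Matrix.of fun i j : Fin 1 => if i.val + j.val + 1 = 1 then (1 : L) else 0)).Local v)),
      MeasurableSpace (((cmDatum L 2 (Matrix.of fun i j : Fin 2 => if i.val + j.val + 1 = 2 then (1 : L) else 0)).Local v ×
          (cmDatum L 1 (Matrix.of fun i j : Fin 1 => if i.val + j.val + 1 = 1 then (1 : L) else 0)).Local v) ⧸
        Subgroup.centralizer ({a} : Set ((cmDatum L 2 (Matrix.of fun i j : Fin 2 => if i.val + j.val + 1 = 2 then (1 : L) else 0)).Local v ×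
          (cmDatum L 1 (Matrix.of fun i j : Fin 1 => if i.val + j.val + 1 = 1 then (1 : L) else 0)).Local v)))]
    [∀ (v : HeightOneSpectrum (𝓞 ↥(maximalRealSubfield L))) (γ : (cmDatum L 3 H).Local v),
      MeasurableSpace ((cmDatum L 3 H).Local v ⧸ Subgroup.centralizer ({γ} : Set ((cmDatum L 3 H).Local v)))]
    (Δ : ∀ v : HeightOneSpectrum (𝓞 ↥(maximalRealSubfield L)), LocalTransferFactor L H v)
    (mH : ∀ v : HeightOneSpectrum (𝓞 ↥(maximalRealSubfield L)),
      OrbitalMeasureFamily ((cmDatum L 2 (Matrix.of fun i j : Fin 2 => if i.val + j.val + 1 = 2 then (1 : L) else 0)).Local v ×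
        (cmDatum L 1 (Matrix.of fun i j : Fin 1 => if i.val + j.val + 1 = 1 then (1 : L) else 0)).Local v))
    (mG : ∀ v : HeightOneSpectrum (𝓞 ↥(maximalRealSubfield L)), OrbitalMeasureFamily ((cmDatum L 3 H).Local v))
    (νG : ∀ v : HeightOneSpectrum (𝓞 ↥(maximalRealSubfield L)), Measure ((cmDatum L 3 H).Local v))
    (νH : ∀ v : HeightOneSpectrum (𝓞 ↥(maximalRealSubfield L)),
      Measure ((cmDatum L 2 (Matrix.of fun i j : Fin 2 => if i.val + j.val + 1 = 2 then (1 : L) else 0)).Local v ×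
        (cmDatum L 1 (Matrix.of fun i j : Fin 1 => if i.val + j.val + 1 = 1 then (1 : L) else 0)).Local v))
    [∀ v : HeightOneSpectrum (𝓞 ↥(maximalRealSubfield L)), BorelSpace ((cmDatum L 3 H).Local v)]
    [∀ v : HeightOneSpectrum (𝓞 ↥(maximalRealSubfield L)),
      BorelSpace ((cmDatum L 2 (Matrix.of fun i j : Fin 2 => if i.val + j.val + 1 = 2 then (1 : L) else 0)).Local v ×
        (cmDatum L 1 (Matrix.of fun i j : Fin 1 => if i.val + j.val + 1 = 1 then (1 : L) else 0)).Local v)]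
    [∀ (v : HeightOneSpectrum (𝓞 ↥(maximalRealSubfield L)))
        (a : ((cmDatum L 2 (Matrix.of fun i j : Fin 2 => if i.val + j.val + 1 = 2 then (1 : L) else 0)).Local v ×
          (cmDatum L 1 (Matrix.of fun i j : Fin 1 => if i.val + j.val + 1 = 1 then (1 : L) else 0)).Local v)),
      BorelSpace (((cmDatum L 2 (Matrix.of fun i j : Fin 2 => if i.val + j.val + 1 = 2 then (1 : L) else 0)).Local v ×
          (cmDatum L 1 (Matrix.of fun i j : Fin 1 => if i.val + j.val + 1 = 1 then (1 : L) else 0)).Local v) ⧸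
        Subgroup.centralizer ({a} : Set ((cmDatum L 2 (Matrix.of fun i j : Fin 2 => if i.val + j.val + 1 = 2 then (1 : L) else 0)).Local v ×
          (cmDatum L 1 (Matrix.of fun i j : Fin 1 => if i.val + j.val + 1 = 1 then (1 : L) else 0)).Local v)))]
    [∀ (v : HeightOneSpectrum (𝓞 ↥(maximalRealSubfield L))) (γ : (cmDatum L 3 H).Local v),
      BorelSpace ((cmDatum L 3 H).Local v ⧸ Subgroup.centralizer ({γ} : Set ((cmDatum L 3 H).Local v)))]
    [∀ v, (νG v).IsHaarMeasure] [∀ v, (νG v).IsMulRightInvariant] [∀ v, (νH v).IsHaarMeasure] [∀ v, (νH v).IsMulRightInvariant],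
    ∀ (μω : HeckeCharacter L) (hμu : μω.IsUnitary),
    (∀ x : Literature.NumberTheory.GaloisRepresentations.ideleGroup ↥(maximalRealSubfield L),
      μω (AdeleRing.ideleBaseChange (↥(maximalRealSubfield L)) L x) = quadraticHeckeCharCM L x) →
    ∀ (μA : Measure (adelicGroupData (↥(maximalRealSubfield L)) L (IsCMField.complexConj L) 3 H).automorphicQuotient)
      [(adelicGroupData (↥(maximalRealSubfield L)) L (IsCMField.complexConj L) 3 H).IsAutomorphicMeasure μA],
    Δ = finExplicitCollection L H μω (finExplicitDelta_conj_left_all L H μω) (finExplicitDelta_conj_right_all L H μω) →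
    (∀ v : HeightOneSpectrum (𝓞 ↥(maximalRealSubfield L)), (mH v).IsCanonical (IsLocalGRegular L v) (νH v) ∧
      (mG v).IsCanonical (fun γ => IsRegularElt (γ.val : GL (Fin 3) (UnitaryGroup.LocalRing L v))) (νG v)) →
    CMCharIdentityPackageTestSigned L H hH hHd νH νG μω hμu Δ mH mG →
    (∀ v : HeightOneSpectrum (𝓞 ↥(maximalRealSubfield L)), (∀ w : PlacesOver L v, IsCMField.complexConj L • w.1 = w.1) →
      IsLocalDeltaTransferExists L H v (Δ v) (mH v) (mG v) Literature.NumberTheory.Rogawski1990.IsLocSmooth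
        Literature.NumberTheory.Rogawski1990.IsLocSmooth) →
    ∀ {n' : ℕ} (e₁ : Fin 3 × Fin 1 ≃ Fin n') (dV : Fin 3 → L) (hdV : ∀ i, IsCMField.complexConj L (dV i) = dV i) (hdV0 : ∀ i, dV i ≠ 0)
      (g : GL (Fin 3) L) (hg : ((g : Matrix (Fin 3) (Fin 3) L).map (cmConjRingHom L))ᵀ * H * (g : Matrix (Fin 3) (Fin 3) L) = Matrix.diagonal dV)
      (ξ : OneDimAutRepH L),
      piSCompletion_isThetaTypeAtCMTestSignedW1 L H Δ mH mG νH νG ξ μω (fun v => ξ.xiLocalChar v) e₁ dV hdV hdV0 g hg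
    := by
  intro L _ _ _ ι H T hT hdef h2 hH hHd _ _ _ _ Δ mH mG νG νH _ _ _ _ _ _ _ _ μω hμu hμω μA _ hΔ hcan hQS hex n' e₁ dV hdV hdV0 g hg ξ
    μ hμ χf hχc hχn hw haut hD1 hD2 v hns Tv a ha h _ _ μZ _ π2 πn hK hn
  obtain ⟨ε, μA', hμA', P, hmem, ⟨c₀, hc₀⟩, hall⟩ :=
    F0P3cDbTThetaOccurrenceLiuLocus.stubThetaLiftMember_liuLocus L ι H T hT hdef h2 hH hHd μω hμu hμω e₁ dV hdV hdV0 g hg ξ μ hμ χf hD1 hD2 μA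
      hw ⟨χf, haut⟩ rfl v hns
  obtain ⟨hsc, hθ⟩ := hall c₀ hc₀
  exact ⟨ε, c₀, O2θ L H hH hHd Δ mH mG νG νH μω hμu hμω hΔ hcan hQS hex e₁ dV hdV hdV0 g hg ξ μ hμ χf hχc hχn hw haut hD1 hD2 v hns Tv a ha h μZ
    π2 πn hK hn ε c₀ hθ hsc, hθ⟩

end Summit.HodgeConjecture.HodgeConjecture.Cruxes.H413.F0P3cDbTThetaRoadW1

end
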